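import Summits.BirchSwinnertonDyer.BirchSwinnertonDyer.Theorems.ManinLocalTwoThreePinningKernelFricke
import Summits.BirchSwinnertonDyer.BirchSwinnertonDyer.Theorems.ManinLocalTwoThreePinningKernelCusp
import HarnessLib

/-!
# THE PINNING KERNEL, part I: the FRICKE-STAGED sieve (Fricke rows as sieve relations, one run per sign)

Cell `bsd-f2-manin`, route `ManinLocalTwoThree`, cruxes C2 `ManinOddAtFour` (stmt-BirchSwinnertonDyer-22967) and
C3 `ManinPrimeToThreeAtNine` (stmt-22968); planner seat -an gen 58 (`--supports` helper, turnkey T-an-g58-L288).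
Level-generic; nothing here proves C2, C3, Manin's conjecture or BSD.

Parts A–G pin the newform `D.f` of an `X₀(N)`-datum on a certified `η`-basis by a staged box sieve whose relations are
CERTIFIED COLUMN RELATIONS of the basis tables (`Σ_n v_n a_n(W) = 0` because `Σ_n v_n t_j[n] = 0` for every basis table),
and part C kills the non-Fricke candidates AFTER the sieve.  At the levels `288 = 2⁵·3²` and `392 = 2³·7²` the column
relations alone leave thousands of assignments alive (`a₂ = a₃ = 0` resp. `a₂ = a₇ = 0` make a `14`- resp. `20`-dimensional
block of the basis invisible to the smooth columns below the table depth).  This part feeds the FRICKE ROWS INTO the sieve: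

* §I1 `frickeCombo`, `exists_sign_frickeCombo_rel`: with integer duals `u` (`⟨uᵢ, tⱼ⟩ = d δᵢⱼ`) the coordinates `x` of
  `D.f = Σ xᵢ Sᵢ` satisfy `d·xᵢ = Σ_{n<K} uᵢ[n] a_n(W)` (part A), and the Fricke relation `D.f ∣ w_N = ε D.f`, `ε = ±1`
  (tree `fricke_coords`) on a `σ`-closed `η`-basis (`Cᵢ ∣ w_N = −(numᵢ/denᵢ) C_{σ i}`, part C) gives the rows
  `ε·denᵢ·x_{σ i} + numᵢ·xᵢ = 0`; hence for THE sign `ε = ε(D.f)` EVERY integer combination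
  `Σ_i w_i (ε·denᵢ·u_{σ i} + numᵢ·uᵢ)` is an integer linear relation among the `a_n(W)`, `n < K`;
* §I2 `relOK`, `untag`, `exists_smul_eq_sum_of_frickeStaged`: stage relations are TAGGED — `(v, none)` a certified
  column relation, `(v, some w)` the expanded Fricke combination `w` (checked by `decide` against `frickeCombo`) — and the
  sieve of part B (`runSieve`, `truth_mem_runSieve`, which takes abstract relations) is run ONCE PER SIGN on two stage
  lists `stP` (`ε = 1`) and `stM` (`ε = −1`) with a common prime list; the truth of `W` survives the run of its own sign, so
  a certified coordinate vector for every survivor of either run pins `D.f` (in `S₂(Γ₀(N))`, read in `M₂(Γ₀(N))`).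
At `288` (`K = 128`, primes `2,3,5,7,11,13`) the live lists have length `≤ 9` and the survivors are exactly Cremona
`288a,b` (`ε = 1`) and `288c,d,e` (`ε = −1`); at `392` (`K = 192`) they are `392a–f` (an g58 `pk_fr58.py`).
[cite: AtkinLehner1970, Thm. 3] [cite: CremonaAlgorithms1997, §2.8, §2.10] [cite: Koehler2011, §2.4]
-/

set_option autoImplicit false
-- lint-debt: the directory name repeats the summit name (sibling precedent `ManinLocalTwoThreePinningKernel.lean`)
set_option linter.dupNamespace false

noncomputable section

open Complex
open UpperHalfPlane hiding I
open scoped MatrixGroups ModularForm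
open ModularForm CongruenceSubgroup
open Literature.NumberTheory.ModularForms
open Literature.NumberTheory.EllipticCurves Literature.NumberTheory.EllipticCurves.ModularForms

namespace Summit.BirchSwinnertonDyer.BirchSwinnertonDyer.Theorems.ManinLocalTwoThree.PinningKernel

open Summit.BirchSwinnertonDyer.BirchSwinnertonDyer.Theorems.ManinLocalTwoThree.LevelFiftyTwo (fricke_coords)

/-! ## §I1 Fricke rows as integer relations among the `aₙ(W)` -/

section Combo

variable {g : ℕ}

/-- The expanded integer combination `n ↦ Σ_i w_i (ε·denᵢ·u_{σ i}[n] + numᵢ·uᵢ[n])`, `n < K`, of the Fricke rows. [folklore] -/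
def frickeCombo (u : Fin g → List ℤ) (sig : Fin g → Fin g) (num den : Fin g → ℕ) (K : ℕ) (ε : ℤ) (w : List ℤ) :
    List ℤ :=
  (List.range K).map fun n ↦
    ∑ i : Fin g, w.getD (i : ℕ) 0 * (ε * den i * (u (sig i)).getD n 0 + num i * (u i).getD n 0)

/-- `frickeCombo` has length `K`. [folklore] -/
theorem length_frickeCombo (u : Fin g → List ℤ) (sig : Fin g → Fin g) (num den : Fin g → ℕ) (K : ℕ) (ε : ℤ)
    (w : List ℤ) : (frickeCombo u sig num den K ε w).length = K := by
  rw [frickeCombo, List.length_map, List.length_range]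

/-- Entries of `frickeCombo`. [folklore] -/
theorem getD_frickeCombo (u : Fin g → List ℤ) (sig : Fin g → Fin g) (num den : Fin g → ℕ) (K : ℕ) (ε : ℤ)
    (w : List ℤ) {n : ℕ} (hn : n < K) :
    (frickeCombo u sig num den K ε w).getD n 0 =
      ∑ i : Fin g, w.getD (i : ℕ) 0 * (ε * den i * (u (sig i)).getD n 0 + num i * (u i).getD n 0) := by
  rw [frickeCombo, List.getD_eq_getElem?_getD, List.getElem?_map, List.getElem?_range hn]
  rfl

/-- Extending a dual read-off `Σ_{n<|u|} u[n]·a n` to the columns `n < K` (`|u| ≤ K`). [folklore] -/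
theorem sum_range_getD_mul_eq {K : ℕ} (u : List ℤ) (hu : u.length ≤ K) (a : ℕ → ℂ) :
    ∑ n ∈ Finset.range K, ((u.getD n 0 : ℤ) : ℂ) * a n = ∑ n ∈ Finset.range u.length, ((u.getD n 0 : ℤ) : ℂ) * a n := by
  symm
  refine Finset.sum_subset (Finset.range_mono hu) fun n _ hn ↦ ?_
  rw [Finset.mem_range, not_lt] at hn
  rw [List.getD_eq_default _ _ hn, Int.cast_zero, zero_mul]

end Combo

section Sign

variable (N : ℕ) [NeZero N] {W : WeierstrassCurve ℚ} [W.IsElliptic] (D : ModularParametrizationData W N)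
  {g K : ℕ} (S : Fin g → CuspForm (Gamma0 N) 2) (C : Fin g → ModularForm (Gamma0 N) 2)
  (hCS : ∀ i, ModularFormClass.modularForm (S i) = C i) (t u : Fin g → List ℤ) (d : ℤ)
  (ht : ∀ i, ∀ n < K, (((t i).getD n 0 : ℤ) : ℂ) = modCoefₗ N 2 n (C i)) (hu : ∀ i, (u i).length ≤ K)
  (hdual : ∀ i j, dotList (u i) (t j) = if i = j then d else 0) (hd : d ≠ 0)
  (hdim : Module.finrank ℂ (CuspForm (Gamma0 N) 2) = g)
  (sig : Fin g → Fin g) (hinj : Function.Injective sig) (num den : Fin g → ℕ) (hden : ∀ i, 0 < den i)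
  (hW : ∀ i, (⇑(C i) : ℍ → ℂ) ∣[(2 : ℤ)] (glCast (frickeGL N : GL (Fin 2) ℚ) : GL (Fin 2) ℝ) =
      ∑ j, frickePhi sig num den j i • (⇑(C j) : ℍ → ℂ))

include D hCS ht hu hdual hd hdim hinj hden hW in
omit [W.IsElliptic] in
/-- **THE FRICKE ROWS ARE SIEVE RELATIONS.**  On a certified `σ`-closed basis of `S₂(Γ₀(N))` with integer duals, for the
Fricke sign `ε = ε(D.f) ∈ {1, −1}` of the datum's newform, EVERY integer combination of the rows
`ε·denᵢ·u_{σ i} + numᵢ·uᵢ` is an integer linear relation among the `aₙ(W)`, `n < K`.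
[cite: AtkinLehner1970, Thm. 3] [cite: Koehler2011, §2.4] -/
theorem exists_sign_frickeCombo_rel :
    ∃ ε : ℤ, (ε = 1 ∨ ε = -1) ∧ ∀ w : List ℤ, (frickeCombo u sig num den K ε w).length ≤ K ∧
      ∑ n ∈ Finset.range (frickeCombo u sig num den K ε w).length,
        (frickeCombo u sig num den K ε w).getD n 0 * W.LFunction n = 0 := by
  haveI : FiniteDimensional ℂ (CuspForm (Gamma0 N) 2) := finiteDimensional_cuspForm_gamma0 N 2
  have htS : ∀ i, ∀ n < K, (((t i).getD n 0 : ℤ) : ℂ) = cuspCoeffₗ (one_mem_strictPeriods_coe_gamma0 N) n (S i) :=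
    fun i n hn ↦ by rw [cuspCoeffₗ_apply, ← modCoefₗ_modularForm (S i) n, hCS]; exact ht i n hn
  have hF : ∀ n, cuspCoeffₗ (one_mem_strictPeriods_coe_gamma0 N) n D.f = ((W.LFunction n : ℤ) : ℂ) :=
    fun n ↦ by rw [cuspCoeffₗ_apply]; exact D.isNewformOf.2 n
  -- coordinates of `D.f` on `S` and their dual read-off `xᵢ·d = Σ_{n<K} uᵢ[n] aₙ(W)`
  obtain ⟨x, hx⟩ := exists_coords_of_dual S t u d htS hu hdual hd hdim D.f
  have hxd : ∀ i, x i * (d : ℂ) = ∑ n ∈ Finset.range K, (((u i).getD n 0 : ℤ) : ℂ) * ((W.LFunction n : ℤ) : ℂ) :=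
    fun i ↦ by
    rw [sum_range_getD_mul_eq (u i) (hu i), ← evalFnₗ_sum_smul S t u d htS hu hdual x i, ← hx, evalFnₗ_apply]
    exact Finset.sum_congr rfl fun n _ ↦ by rw [hF n]
  -- `D.f = Σ xᵢ Cᵢ` as functions, and the Fricke rows of `x`
  have hf : (⇑D.f : ℍ → ℂ) = ∑ i, x i • (⇑(C i) : ℍ → ℂ) := by
    have h1 := smul_modularForm_eq_sum D.f S C hCS 1 x (by rw [one_smul]; exact hx)
    rw [one_smul] at h1
    have h3 : (⇑D.f : ℍ → ℂ) = ⇑(ModularFormClass.modularForm D.f : ModularForm (Gamma0 N) 2) := rfl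
    rw [h3, h1, coe_sum_smul]
  have hli : LinearIndependent ℂ C := linearIndependent_of_dual C t u d ht hu hdual hd
  obtain ⟨ε, hε, hrows⟩ := fricke_coords D (fun i ↦ (⇑(C i) : ℍ → ℂ)) (linearIndependent_coe C hli) x hf
    (frickePhi sig num den) hW
  have key : ∀ i, ε * (den i : ℂ) * x (sig i) + (num i : ℂ) * x i = 0 := fun i ↦ by
    have h := hrows (sig i)
    rw [Finset.sum_eq_single i (fun j _ hj ↦ by rw [frickePhi, if_neg (fun e ↦ hj (hinj e)), zero_mul])
      (fun h ↦ absurd (Finset.mem_univ i) h)] at h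
    have h1 : frickePhi sig num den (sig i) i = -(((num i : ℝ) / den i : ℝ) : ℂ) := by rw [frickePhi, if_pos rfl]
    rw [h1] at h
    have hdi : ((den i : ℕ) : ℂ) ≠ 0 := by exact_mod_cast (hden i).ne'
    have h3 : (((num i : ℝ) / den i : ℝ) : ℂ) * (den i : ℂ) = num i := by push_cast; exact div_mul_cancel₀ _ hdi
    calc ε * (den i : ℂ) * x (sig i) + (num i : ℂ) * x i
        = (ε * x (sig i)) * den i + (num i : ℂ) * x i := by ring
      _ = (-(((num i : ℝ) / den i : ℝ) : ℂ) * x i) * den i + (num i : ℂ) * x i := by rw [← h]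
      _ = -((((num i : ℝ) / den i : ℝ) : ℂ) * den i) * x i + (num i : ℂ) * x i := by ring
      _ = 0 := by rw [h3]; ring
  -- the integer sign
  obtain ⟨e, he, hεe⟩ : ∃ e : ℤ, (e = 1 ∨ e = -1) ∧ (ε : ℂ) = ((e : ℤ) : ℂ) := by
    rcases hε with rfl | rfl
    · exact ⟨1, Or.inl rfl, by push_cast; rfl⟩
    · exact ⟨-1, Or.inr rfl, by push_cast; rfl⟩
  refine ⟨e, he, fun w ↦ ⟨(length_frickeCombo u sig num den K e w).le, ?_⟩⟩
  rw [length_frickeCombo]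
  -- cast to `ℂ` and swap the sums
  have hC : ∑ n ∈ Finset.range K, (((frickeCombo u sig num den K e w).getD n 0 : ℤ) : ℂ) * ((W.LFunction n : ℤ) : ℂ) = 0 := by
    calc ∑ n ∈ Finset.range K, (((frickeCombo u sig num den K e w).getD n 0 : ℤ) : ℂ) * ((W.LFunction n : ℤ) : ℂ)
        = ∑ n ∈ Finset.range K, ∑ i : Fin g, ((w.getD (i : ℕ) 0 : ℤ) : ℂ) *
            ((e : ℂ) * (den i : ℂ) * ((((u (sig i)).getD n 0 : ℤ) : ℂ) * ((W.LFunction n : ℤ) : ℂ)) +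
              (num i : ℂ) * ((((u i).getD n 0 : ℤ) : ℂ) * ((W.LFunction n : ℤ) : ℂ))) := by
          refine Finset.sum_congr rfl fun n hn ↦ ?_
          rw [getD_frickeCombo u sig num den K e w (Finset.mem_range.mp hn)]
          push_cast
          rw [Finset.sum_mul]
          exact Finset.sum_congr rfl fun i _ ↦ by ring
      _ = ∑ i : Fin g, ((w.getD (i : ℕ) 0 : ℤ) : ℂ) *
            ((e : ℂ) * (den i : ℂ) * (x (sig i) * d) + (num i : ℂ) * (x i * d)) := by
          rw [Finset.sum_comm]
          refine Finset.sum_congr rfl fun i _ ↦ ?_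
          rw [← Finset.mul_sum, Finset.sum_add_distrib, ← Finset.mul_sum, ← Finset.mul_sum, ← hxd (sig i), ← hxd i]
      _ = ∑ i : Fin g, ((w.getD (i : ℕ) 0 : ℤ) : ℂ) * (d : ℂ) * (ε * (den i : ℂ) * x (sig i) + (num i : ℂ) * x i) := by
          rw [hεe]
          exact Finset.sum_congr rfl fun i _ ↦ by ring
      _ = 0 := Finset.sum_eq_zero fun i _ ↦ by rw [key i, mul_zero]
  exact_mod_cast hC

end Sign

/-! ## §I2 Tagged stage relations; the sieve run once per sign -/

section Staged

variable {g : ℕ}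

/-- The decidable check of a TAGGED stage relation for the sign `ε`: `(v, none)` is a certified column relation of the
tables (`|v| ≤ K`, `⟨v, tⱼ⟩ = 0` for all `j`); `(v, some w)` is the expanded Fricke combination `w`. [folklore] -/
def relOK (t u : Fin g → List ℤ) (sig : Fin g → Fin g) (num den : Fin g → ℕ) (K : ℕ) (ε : ℤ)
    (r : List ℤ × Option (List ℤ)) : Bool :=
  match r.2 with
  | none => decide (r.1.length ≤ K ∧ ∀ j : Fin g, dotList r.1 (t j) = 0)
  | some w => decide (r.1 = frickeCombo u sig num den K ε w)

/-- Forgetting the tags: the stage list the sieve of part B runs on. [folklore] -/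
def untag (sts : List (ℕ × List (List ℤ × Option (List ℤ)))) : List (ℕ × List (List ℤ)) :=
  sts.map fun st ↦ (st.1, st.2.map Prod.fst)

/-- The prime list of the untagged stages. [folklore] -/
theorem map_fst_untag (sts : List (ℕ × List (List ℤ × Option (List ℤ)))) :
    (untag sts).map Prod.fst = sts.map Prod.fst := by
  rw [untag, List.map_map]
  rfl

end Staged

section FrickeStaged

variable (N : ℕ) [NeZero N] {W : WeierstrassCurve ℚ} [W.IsElliptic] (D : ModularParametrizationData W N)
  {g K : ℕ} (S : Fin g → CuspForm (Gamma0 N) 2) (C : Fin g → ModularForm (Gamma0 N) 2)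
  (hCS : ∀ i, ModularFormClass.modularForm (S i) = C i) (t u : Fin g → List ℤ) (d : ℤ)
  (ht : ∀ i, ∀ n < K, (((t i).getD n 0 : ℤ) : ℂ) = modCoefₗ N 2 n (C i)) (hu : ∀ i, (u i).length ≤ K)
  (hdual : ∀ i j, dotList (u i) (t j) = if i = j then d else 0) (hd : d ≠ 0)
  (hdim : Module.finrank ℂ (CuspForm (Gamma0 N) 2) = g)
  (sig : Fin g → Fin g) (hinj : Function.Injective sig) (num den : Fin g → ℕ) (hden : ∀ i, 0 < den i)
  (hW : ∀ i, (⇑(C i) : ℍ → ℂ) ∣[(2 : ℤ)] (glCast (frickeGL N : GL (Fin 2) ℚ) : GL (Fin 2) ℝ) =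
      ∑ j, frickePhi sig num den j i • (⇑(C j) : ℍ → ℂ))

include hCS ht hu hdual hd hdim in
/-- One run of the sieve for a sign `ε` whose Fricke combinations ARE relations: the truth survives, so a certified
coordinate vector for every survivor pins `D.f`. [cite: CremonaAlgorithms1997, §2.10] -/
theorem exists_smul_eq_sum_of_run (ε : ℤ)
    (hε : ∀ w : List ℤ, (frickeCombo u sig num den K ε w).length ≤ K ∧
      ∑ n ∈ Finset.range (frickeCombo u sig num den K ε w).length,
        (frickeCombo u sig num den K ε w).getD n 0 * W.LFunction n = 0)
    (st : List (ℕ × List (List ℤ × Option (List ℤ)))) (hps : ∀ p ∈ st.map Prod.fst, p.Prime)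
    (hst : ∀ s ∈ st, ∀ r ∈ s.2, relOK t u sig num den K ε r = true)
    (cert : List (List (ℕ × ℤ) × ℤ × List ℤ))
    (hcover : ∀ σ ∈ runSieve N K (untag st), σ ∈ cert.map Prod.fst)
    (hpiv : ∀ c ∈ cert, ∀ i, ∀ n < (u i).length, (u i).getD n 0 ≠ 0 →
      (evalOpt N c.1 n).map (fun x ↦ c.2.1 * x) = some (∑ j : Fin g, c.2.2.getD (j : ℕ) 0 * (t j).getD n 0)) :
    ∃ c ∈ cert, c.1 = truth W (st.map Prod.fst) ∧
      ((c.2.1 : ℤ) : ℂ) • D.f = ∑ j : Fin g, ((c.2.2.getD (j : ℕ) 0 : ℤ) : ℂ) • S j ∧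
      ((c.2.1 : ℤ) : ℂ) • (ModularFormClass.modularForm D.f : ModularForm (Gamma0 N) 2) =
        ∑ j : Fin g, ((c.2.2.getD (j : ℕ) 0 : ℤ) : ℂ) • C j := by
  haveI : FiniteDimensional ℂ (CuspForm (Gamma0 N) 2) := finiteDimensional_cuspForm_gamma0 N 2
  have htS : ∀ i, ∀ n < K, (((t i).getD n 0 : ℤ) : ℂ) = cuspCoeffₗ (one_mem_strictPeriods_coe_gamma0 N) n (S i) :=
    fun i n hn ↦ by rw [cuspCoeffₗ_apply, ← modCoefₗ_modularForm (S i) n, hCS]; exact ht i n hn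
  have hF : ∀ n, cuspCoeffₗ (one_mem_strictPeriods_coe_gamma0 N) n D.f = ((W.LFunction n : ℤ) : ℂ) :=
    fun n ↦ by rw [cuspCoeffₗ_apply]; exact D.isNewformOf.2 n
  have hps' : ∀ s ∈ untag st, s.1.Prime := fun s hs ↦
    hps s.1 (by rw [← map_fst_untag]; exact List.mem_map.mpr ⟨s, hs, rfl⟩)
  have hrels : ∀ s ∈ untag st, ∀ v ∈ s.2,
      v.length ≤ K ∧ ∑ n ∈ Finset.range v.length, v.getD n 0 * W.LFunction n = 0 := by
    intro s hs v hv
    obtain ⟨s', hs', rfl⟩ := List.mem_map.mp hs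
    obtain ⟨r, hr, rfl⟩ := List.mem_map.mp hv
    have hok := hst s' hs' r hr
    rcases hr2 : r.2 with _ | w
    · rw [relOK, hr2, decide_eq_true_eq] at hok
      exact isRelation_of_cert D.f hF S t u d htS hu hdual hd hdim hok.1 hok.2
    · rw [relOK, hr2, decide_eq_true_eq] at hok
      rw [hok]
      exact hε w
  have hmem := hcover _ (truth_mem_runSieve D (untag st) hps' hrels)
  rw [map_fst_untag] at hmem
  obtain ⟨c, hc, hc1⟩ := List.mem_map.mp hmem
  have hσ : ∀ q ∈ c.1, q.1.Prime ∧ q.2 = W.LFunction q.1 := by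
    rw [hc1]; exact truthful_truth hps
  have hpin := smul_eq_sum_of_candidate D D.f hF S t u d htS hu hdual hd hdim hσ c.2.1
    (fun j : Fin g ↦ c.2.2.getD (j : ℕ) 0) (hpiv c hc)
  exact ⟨c, hc, hc1, hpin, smul_modularForm_eq_sum D.f S C hCS _ (fun j ↦ ((c.2.2.getD (j : ℕ) 0 : ℤ) : ℂ)) hpin⟩

include hCS ht hu hdual hd hdim hinj hden hW in
/-- **PINNING BY THE FRICKE-STAGED SIEVE, LIST FORM, IN `S₂(Γ₀(N))` READ IN `M₂(Γ₀(N))`.**  Let `S` be a certified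
`σ`-closed basis of `S₂(Γ₀(N))` (tables `t` of the `M₂`-images `C` to depth `K`, integer duals `u`, `⟨uᵢ, tⱼ⟩ = d δᵢⱼ`,
`dim S₂ = g`, Fricke law `Cᵢ ∣ w_N = −(numᵢ/denᵢ) C_{σ i}`).  Run the staged sieve twice over the same primes, with tagged
relations checked for `ε = 1` (`stP`) and for `ε = −1` (`stM`).  If every survivor of either run comes with a certified
coordinate vector (`certP`, `certM`), then for one listed `(σ, d', y)`: `σ` is the truth of `W`, `d' • D.f = Σ_j y_j • S_j`
in `S₂(Γ₀(N))` and `d' • D.f = Σ_j y_j • C_j` in `M₂(Γ₀(N))`.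
[cite: AtkinLehner1970, Thm. 3] [cite: CremonaAlgorithms1997, §2.8, §2.10] -/
theorem exists_smul_eq_sum_of_frickeStaged (ps : List ℕ) (hps : ∀ p ∈ ps, p.Prime)
    (stP stM : List (ℕ × List (List ℤ × Option (List ℤ))))
    (hpsP : stP.map Prod.fst = ps) (hpsM : stM.map Prod.fst = ps)
    (hP : ∀ s ∈ stP, ∀ r ∈ s.2, relOK t u sig num den K 1 r = true)
    (hM : ∀ s ∈ stM, ∀ r ∈ s.2, relOK t u sig num den K (-1) r = true)
    (certP certM : List (List (ℕ × ℤ) × ℤ × List ℤ))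
    (hcoverP : ∀ σ ∈ runSieve N K (untag stP), σ ∈ certP.map Prod.fst)
    (hcoverM : ∀ σ ∈ runSieve N K (untag stM), σ ∈ certM.map Prod.fst)
    (hpiv : ∀ c ∈ certP ++ certM, ∀ i, ∀ n < (u i).length, (u i).getD n 0 ≠ 0 →
      (evalOpt N c.1 n).map (fun x ↦ c.2.1 * x) = some (∑ j : Fin g, c.2.2.getD (j : ℕ) 0 * (t j).getD n 0)) :
    ∃ c ∈ certP ++ certM, c.1 = truth W ps ∧
      ((c.2.1 : ℤ) : ℂ) • D.f = ∑ j : Fin g, ((c.2.2.getD (j : ℕ) 0 : ℤ) : ℂ) • S j ∧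
      ((c.2.1 : ℤ) : ℂ) • (ModularFormClass.modularForm D.f : ModularForm (Gamma0 N) 2) =
        ∑ j : Fin g, ((c.2.2.getD (j : ℕ) 0 : ℤ) : ℂ) • C j := by
  obtain ⟨ε, hε, hrel⟩ := exists_sign_frickeCombo_rel N D S C hCS t u d ht hu hdual hd hdim sig hinj num den hden hW
  rcases hε with rfl | rfl
  · obtain ⟨c, hc, h1, h2, h3⟩ := exists_smul_eq_sum_of_run N D S C hCS t u d ht hu hdual hd hdim sig num den 1 hrel
      stP (by rw [hpsP]; exact hps) hP certP hcoverP (fun c hc ↦ hpiv c (List.mem_append_left _ hc))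
    exact ⟨c, List.mem_append_left _ hc, by rw [h1, hpsP], h2, h3⟩
  · obtain ⟨c, hc, h1, h2, h3⟩ := exists_smul_eq_sum_of_run N D S C hCS t u d ht hu hdual hd hdim sig num den (-1) hrel
      stM (by rw [hpsM]; exact hps) hM certM hcoverM (fun c hc ↦ hpiv c (List.mem_append_right _ hc))
    exact ⟨c, List.mem_append_right _ hc, by rw [h1, hpsM], h2, h3⟩

end FrickeStaged

end Summit.BirchSwinnertonDyer.BirchSwinnertonDyer.Theorems.ManinLocalTwoThree.PinningKernel

end
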